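import Summits.BirchSwinnertonDyer.Rank1Residual.GaloisImage.ThreeCongruenceCubeLaw
import Mathlib.RingTheory.Polynomial.RationalRoot
import HarnessLib

/-!
# Cube certificates over `ℚ` for the Δ-cube law: `n` is not a rational cube if it is not a cube
# modulo some `m` (cell `b2b-bsdres`, team n1011, seat p02 gen 10 — row T-E3SYMP, file F4; TOOL
# for the records lanes)

HONEST FRAMING (cell `b2b-bsdres`, run/shared/lean/b2b/bsd-rank1-residual/, verbatim in every
file): the goal of the cell is to DELETE the COMBINATION-SHAPED residual classes of the
Birch–Swinnerton-Dyer formula for ALL analytic-rank `≤ 1` elliptic curves over `ℚ` — "full BSD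
formula for every rank `≤ 1` curve in class `C`" assembled STRICTLY from published theorems — so
that the rank-`≤ 1` remainder becomes exactly the CONSTRUCTION-SHAPED classes, which are TYPED
(missing-input `Prop`s), NOT attempted. This is not "finishing BSD". Team n1011 (N10 / N11):
research route; no claim beyond the stated classes; labels UNCHANGED; nothing is booked. Theorems
only (no definition, no named fact).

## What this file proves

The hypotheses `∀ c : ℚ, W.Δ ≠ c³ · W′.Δ` / `∀ c : ℚ, W.Δ · W′.Δ ≠ c³` displayed by the deciders and
the NO-GO of file F3b (`ThreeCongruenceCubeLaw`) are discharged, for curves over `ℚ`, by a FINITE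
certificate: an integer that is not a cube modulo some `m` is not the cube of a rational number
(rational root theorem: a rational cube root of an integer is an integer).

* `intCast_ne_pow_three_of_zmod` — `(∀ r : ZMod m, r³ ≠ n) → ∀ c : ℚ, (n : ℚ) ≠ c³`
  (`decide`-able hypothesis for literal `m, n`; e.g. the cubes mod `7` are `0, ±1`, mod `9` are
  `0, ±1`, mod `13` are `0, ±1, ±5`).
* `forall_Δ_mul_Δ_ne_cube_of_zmod` — from `W.Δ · W′.Δ = n` and a certificate for `n`;
  `forall_Δ_ne_cube_mul_Δ_of_zmod` — from `W.Δ · W′.Δ² = n` and a certificate for `n`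
  (`Δ = c³Δ′ ⇒ ΔΔ′² = (cΔ′)³`).
* `not_threeCongruent_of_zmod` — two certificates ⇒ `E`, `E′` are NOT `3`-congruent over `ℚ`;
  `symplectic_of_zmod` / `antisymplectic_of_zmod` — one certificate ⇒ every `Γ_ℚ`-equivariant
  `θ : E′[3] ≃ E[3]` is symplectic (resp. anti-symplectic) FOR THE CUBE-ROOT PAIRINGS (N) (no
  identification with the divisor-theoretic Weil pairing is claimed; see F3a/F3b).

References (context): r1 ROUTE-1 §43.2 (D), §43.3; Fisher 2012 Rem. 8.6.
-/

noncomputable section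

open scoped Classical

open Polynomial WeierstrassCurve Literature.NumberTheory.EllipticCurves

namespace Summit.BirchSwinnertonDyer.Rank1Residual.GaloisImage.CubeRootPairing

/-- **A cube certificate.** If the integer `n` is not a cube modulo `m`, then `n` is not the cube
of a rational number (a rational root of the monic `X³ − n ∈ ℤ[X]` is an integer).
[folklore] -/
theorem intCast_ne_pow_three_of_zmod {m : ℕ} {n : ℤ} (h : ∀ r : ZMod m, r ^ 3 ≠ (n : ZMod m))
    (c : ℚ) : (n : ℚ) ≠ c ^ 3 := by
  intro hc
  have hmonic : (X ^ 3 - C n : ℤ[X]).Monic := monic_X_pow_sub_C n (by norm_num)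
  have hroot : aeval c (X ^ 3 - C n : ℤ[X]) = 0 := by
    simp only [map_sub, map_pow, aeval_X, aeval_C, algebraMap_int_eq, Int.coe_castRingHom, ← hc,
      sub_self]
  obtain ⟨z, hz, -⟩ := exists_integer_of_is_root_of_monic hmonic hroot
  have hz3 : z ^ 3 = n := by
    have : ((z : ℚ)) ^ 3 = (n : ℚ) := by
      rw [hc, hz, algebraMap_int_eq, Int.coe_castRingHom]
    exact_mod_cast this
  exact h (z : ZMod m) (by rw [← Int.cast_pow, hz3])

variable (W W' : WeierstrassCurve ℚ)

/-- `W.Δ · W′.Δ = n` with `n` not a cube mod `m` ⇒ `∀ c : ℚ, W.Δ · W′.Δ ≠ c³`. [folklore] -/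
theorem forall_Δ_mul_Δ_ne_cube_of_zmod {m : ℕ} {n : ℤ} (hn : W.Δ * W'.Δ = n)
    (h : ∀ r : ZMod m, r ^ 3 ≠ (n : ZMod m)) : ∀ c : ℚ, W.Δ * W'.Δ ≠ c ^ 3 := fun c hc =>
  intCast_ne_pow_three_of_zmod h c (by rw [← hn, hc])

/-- `W.Δ · W′.Δ² = n` with `n` not a cube mod `m` ⇒ `∀ c : ℚ, W.Δ ≠ c³ · W′.Δ`
(`Δ = c³Δ′ ⇒ ΔΔ′² = (cΔ′)³`). [folklore] -/
theorem forall_Δ_ne_cube_mul_Δ_of_zmod {m : ℕ} {n : ℤ} (hn : W.Δ * W'.Δ ^ 2 = n)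
    (h : ∀ r : ZMod m, r ^ 3 ≠ (n : ZMod m)) : ∀ c : ℚ, W.Δ ≠ c ^ 3 * W'.Δ := fun c hc =>
  intCast_ne_pow_three_of_zmod h (c * W'.Δ) (by rw [← hn, hc]; ring)

/-- **NO-GO by two cube certificates**: if `W.Δ · W′.Δ²` is not a cube mod `m₁` and `W.Δ · W′.Δ`
is not a cube mod `m₂`, then there is no `Γ_ℚ`-equivariant `E′[3] ≃ E[3]` (`E`, `E′` are not
`3`-congruent over `ℚ`). [folklore] -/
theorem not_threeCongruent_of_zmod [W.IsElliptic] [W'.IsElliptic] {m₁ m₂ : ℕ} {n₁ n₂ : ℤ}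
    (hn₁ : W.Δ * W'.Δ ^ 2 = n₁) (h₁ : ∀ r : ZMod m₁, r ^ 3 ≠ (n₁ : ZMod m₁))
    (hn₂ : W.Δ * W'.Δ = n₂) (h₂ : ∀ r : ZMod m₂, r ^ 3 ≠ (n₂ : ZMod m₂)) :
    ¬ ∃ θ : geomTorsion W' 3 ≃+ geomTorsion W 3,
      ∀ (σ : Field.absoluteGaloisGroup ℚ) (P : geomTorsion W' 3), θ (σ • P) = σ • θ P :=
  not_threeCongruent_of_forall_ne_cube W W' (forall_Δ_ne_cube_mul_Δ_of_zmod W W' hn₁ h₁)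
    (forall_Δ_mul_Δ_ne_cube_of_zmod W W' hn₂ h₂)

/-- **One certificate reads the Δ-cube law**: if `W.Δ · W′.Δ` is not a cube mod `m` then every
`Γ_ℚ`-equivariant `θ : E′[3] ≃ E[3]` gives `W.Δ = c³ · W′.Δ` for some `c ∈ ℚ`. [folklore] -/
theorem exists_Δ_eq_cube_mul_Δ_of_zmod [W.IsElliptic] [W'.IsElliptic] {m : ℕ} {n : ℤ}
    (hn : W.Δ * W'.Δ = n) (h : ∀ r : ZMod m, r ^ 3 ≠ (n : ZMod m))
    (θ : geomTorsion W' 3 ≃+ geomTorsion W 3)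
    (hθ : ∀ (σ : Field.absoluteGaloisGroup ℚ) (P : geomTorsion W' 3), θ (σ • P) = σ • θ P) :
    ∃ c : ℚ, W.Δ = c ^ 3 * W'.Δ := by
  rcases Δ_eq_cube_mul_or_mul_eq_cube_of_threeCongruent W W' θ hθ with hc | ⟨c, hc⟩
  · exact hc
  · exact absurd hc (forall_Δ_mul_Δ_ne_cube_of_zmod W W' hn h c)

/-- Dually: if `W.Δ · W′.Δ²` is not a cube mod `m` then every `Γ_ℚ`-equivariant
`θ : E′[3] ≃ E[3]` gives `W.Δ · W′.Δ = c³` for some `c ∈ ℚ`. [folklore] -/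
theorem exists_Δ_mul_Δ_eq_cube_of_zmod [W.IsElliptic] [W'.IsElliptic] {m : ℕ} {n : ℤ}
    (hn : W.Δ * W'.Δ ^ 2 = n) (h : ∀ r : ZMod m, r ^ 3 ≠ (n : ZMod m))
    (θ : geomTorsion W' 3 ≃+ geomTorsion W 3)
    (hθ : ∀ (σ : Field.absoluteGaloisGroup ℚ) (P : geomTorsion W' 3), θ (σ • P) = σ • θ P) :
    ∃ c : ℚ, W.Δ * W'.Δ = c ^ 3 := by
  rcases Δ_eq_cube_mul_or_mul_eq_cube_of_threeCongruent W W' θ hθ with ⟨c, hc⟩ | hc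
  · exact absurd hc (forall_Δ_ne_cube_mul_Δ_of_zmod W W' hn h c)
  · exact hc

/-- Sanity check of the certificate shape: `2` is not a cube modulo `7`. [folklore] -/
example : ∀ r : ZMod 7, r ^ 3 ≠ ((2 : ℤ) : ZMod 7) := by decide

end Summit.BirchSwinnertonDyer.Rank1Residual.GaloisImage.CubeRootPairing

end
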